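import Literature.Analysis.OperatorTheory.NuclearDiagonalBound
import HarnessLib

/-!
# The diagonal of a nuclear operator `Σ_k λ_k |p_k⟩⟨q_k|` along a Hilbert basis of a CLOSED SUBSPACE `V`:
# its sum is the basis-free number `Σ_k λ_k ⟨q_k, P_V p_k⟩`, and the sandwiched form `X T Y`

LABEL (line 1): RH-FREE generic Hilbert-space toolkit (theorems only; NO definition, NO named fact).  Used by
the "annulus road" under `Connes1999_thm_VII_4_rat` (cell `rh-crit`, sub-cell cc, row O1): step (iv-b) of the
separated-remainder estimate — the uniform trace-norm bound (S1) and the basis independence (S0) of the diagonal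
series of `ϑ(g) T_M ϑ_m` along Hilbert bases of `L²(ℝ)_ev`, `T_M = Σ_k λ_k |u_k⟩⟨w_k|` the rank-one expansion of the
separated sinc operator.  WHAT THIS IS NOT: anything about RH.

Source.  M. Reed, B. Simon, *Methods of Modern Mathematical Physics I* (1972) [`ReedSimon1972`], Thm. VI.18,
VI.24 (the trace of a trace-class operator along any orthonormal basis; `Tr(AB) = Tr(BA)`), PDF pp. 196–199;
Parseval's identity in the closed subspace `V`.

## What is proved

* `HilbertBasis.hasSum_inner_mul_inner_coe` — Parseval in a closed subspace seen from the ambient space: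
  for a Hilbert basis `(f_i)` of `V ≤ E` and `x, y ∈ E`, `Σ_i ⟨x, f_i⟩⟨f_i, y⟩ = ⟨x, P_V y⟩`;
* **`tsum_tsum_rankOne_diag_coe_eq`** — if `Σ_k |λ_k| (‖p_k‖² + ‖q_k‖²) < ∞` then along every Hilbert basis
  `(f_i)` of `V`, `Σ_i Σ_k λ_k ⟨f_i, p_k⟩⟨q_k, f_i⟩ = Σ_k λ_k ⟨q_k, P_V p_k⟩` (absolutely convergent, basis free);
* **`rankOne_sandwich_diag_coe`** — if `T φ = Σ_k λ_k ⟨w_k, φ⟩ u_k` for all `φ` with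
  `Σ_k |λ_k| (‖u_k‖² + ‖w_k‖²) < ∞`, then for bounded `X, Y` and every Hilbert basis `(f_i)` of `V` the diagonal
  series `Σ_i ⟨f_i, X T Y f_i⟩` is absolutely summable, `Σ_i |⟨f_i, X T Y f_i⟩| ≤ (‖X‖² + ‖Y‖²) Σ_k |λ_k|(‖u_k‖² + ‖w_k‖²)`,
  and `Σ_i ⟨f_i, X T Y f_i⟩ = Σ_k λ_k ⟨Y† w_k, P_V X u_k⟩`.

No instance, notation or attribute; no `def`.
-/

noncomputable section

open Filter
open scoped Topology ComplexConjugate InnerProductSpace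

namespace Literature.Analysis.OperatorTheory

variable {E : Type*} [NormedAddCommGroup E] [InnerProductSpace ℂ E] [CompleteSpace E]
variable {ι κ : Type*} {V : Submodule ℂ E} [V.HasOrthogonalProjection]

omit [CompleteSpace E] in
/-- **Parseval in a closed subspace, seen from the ambient space**: for a Hilbert basis `(f_i)` of `V` and
`x, y ∈ E`, `Σ_i ⟨x, f_i⟩⟨f_i, y⟩ = ⟨x, P_V y⟩` (`⟨x, f_i⟩ = ⟨P_V x, f_i⟩_V`). [cite: ReedSimon1972, Thm. VI.24 (proof), PDF p. 199] -/
theorem HilbertBasis.hasSum_inner_mul_inner_coe (f : HilbertBasis ι ℂ V) (x y : E) :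
    HasSum (fun i => ⟪x, (f i : E)⟫_ℂ * ⟪(f i : E), y⟫_ℂ) ⟪x, V.starProjection y⟫_ℂ := by
  have h := f.hasSum_inner_mul_inner (V.orthogonalProjectionOnto x) (V.orthogonalProjectionOnto y)
  have h1 : ∀ i, ⟪V.orthogonalProjectionOnto x, f i⟫_ℂ = ⟪x, (f i : E)⟫_ℂ := fun i =>
    Submodule.inner_orthogonalProjectionOnto_eq_of_mem_right (f i) x
  have h2 : ∀ i, ⟪f i, V.orthogonalProjectionOnto y⟫_ℂ = ⟪(f i : E), y⟫_ℂ := fun i =>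
    Submodule.inner_orthogonalProjectionOnto_eq_of_mem_left (f i) y
  have hval : ⟪V.orthogonalProjectionOnto x, V.orthogonalProjectionOnto y⟫_ℂ = ⟪x, V.starProjection y⟫_ℂ := by
    rw [Submodule.inner_orthogonalProjectionOnto_eq_of_mem_left, ← Submodule.starProjection_apply,
      Submodule.inner_starProjection_left_eq_right]
  simp only [h1, h2, hval] at h
  exact h

omit [CompleteSpace E] [V.HasOrthogonalProjection] in
/-- The coerced Hilbert basis of `V` is an orthonormal family of `E`. [cite: ReedSimon1972, Thm. VI.24, PDF p. 199] -/
theorem HilbertBasis.orthonormal_coe (f : HilbertBasis ι ℂ V) : Orthonormal ℂ (fun i => (f i : E)) :=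
  (V.subtypeₗᵢ.orthonormal_comp_iff (v := fun i => f i)).mpr f.orthonormal

omit [CompleteSpace E] in
/-- **The compressed nuclear diagonal is basis free**: if `Σ_k |λ_k|(‖p_k‖² + ‖q_k‖²) < ∞` then along every
Hilbert basis `(f_i)` of the closed subspace `V`,
`Σ_i Σ_k λ_k ⟨f_i, p_k⟩⟨q_k, f_i⟩ = Σ_k λ_k ⟨q_k, P_V p_k⟩` ("`Tr(P_V A P_V)`" of `A = Σ_k λ_k |p_k⟩⟨q_k|`, computed
by `Tr(|p⟩⟨q| P_V) = ⟨q, P_V p⟩`). [cite: ReedSimon1972, Thm. VI.18 and VI.24, PDF pp. 196–199] -/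
theorem tsum_tsum_rankOne_diag_coe_eq (f : HilbertBasis ι ℂ V) (p q : κ → E) (lam : κ → ℂ)
    (hsum : Summable fun k => ‖lam k‖ * (‖p k‖ ^ 2 + ‖q k‖ ^ 2)) :
    (Summable fun k => lam k * ⟪q k, V.starProjection (p k)⟫_ℂ) ∧
    ∑' i, ∑' k, lam k * (⟪(f i : E), p k⟫_ℂ * ⟪q k, (f i : E)⟫_ℂ) =
      ∑' k, lam k * ⟪q k, V.starProjection (p k)⟫_ℂ := by
  have he := HilbertBasis.orthonormal_coe f
  obtain ⟨hA, -, -⟩ := tsum_norm_rankOne_diag_le he p q lam hsum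
  -- the inner sums, by Parseval in `V`
  have hinner : ∀ k, HasSum (fun i => lam k * (⟪(f i : E), p k⟫_ℂ * ⟪q k, (f i : E)⟫_ℂ))
      (lam k * ⟪q k, V.starProjection (p k)⟫_ℂ) := fun k => by
    have h := (HilbertBasis.hasSum_inner_mul_inner_coe f (q k) (p k)).mul_left (lam k)
    refine h.congr_fun fun i => ?_
    ring
  -- swap the absolutely convergent double series
  have hA' : Summable fun ki : κ × ι => lam ki.1 * (⟪(f ki.2 : E), p ki.1⟫_ℂ * ⟪q ki.1, (f ki.2 : E)⟫_ℂ) :=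
    (Equiv.prodComm κ ι).summable_iff.2 hA |>.congr fun _ => rfl
  have hk : Summable fun k => lam k * ⟪q k, V.starProjection (p k)⟫_ℂ := by
    have := hA'.prod
    refine this.congr fun k => (hinner k).tsum_eq
  refine ⟨hk, ?_⟩
  calc ∑' i, ∑' k, lam k * (⟪(f i : E), p k⟫_ℂ * ⟪q k, (f i : E)⟫_ℂ)
      = ∑' ik : ι × κ, lam ik.2 * (⟪(f ik.1 : E), p ik.2⟫_ℂ * ⟪q ik.2, (f ik.1 : E)⟫_ℂ) := (hA.tsum_prod).symm
    _ = ∑' ki : κ × ι, lam ki.1 * (⟪(f ki.2 : E), p ki.1⟫_ℂ * ⟪q ki.1, (f ki.2 : E)⟫_ℂ) :=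
        ((Equiv.prodComm κ ι).tsum_eq (fun ik : ι × κ =>
          lam ik.2 * (⟪(f ik.1 : E), p ik.2⟫_ℂ * ⟪q ik.2, (f ik.1 : E)⟫_ℂ))).symm
    _ = ∑' k, ∑' i, lam k * (⟪(f i : E), p k⟫_ℂ * ⟪q k, (f i : E)⟫_ℂ) := hA'.tsum_prod
    _ = ∑' k, lam k * ⟪q k, V.starProjection (p k)⟫_ℂ := tsum_congr fun k => (hinner k).tsum_eq

/-- **The sandwiched nuclear diagonal along a Hilbert basis of a closed subspace.**  If
`T φ = Σ_k λ_k ⟨w_k, φ⟩ u_k` (norm-convergent) for every `φ`, with `Σ_k |λ_k|(‖u_k‖² + ‖w_k‖²) < ∞`, then for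
bounded `X, Y` and every Hilbert basis `(f_i)` of `V`: the diagonal series of `X T Y` along `(f_i)` is absolutely
summable, `Σ_i |⟨f_i, X T Y f_i⟩| ≤ (‖X‖² + ‖Y‖²) · Σ_k |λ_k|(‖u_k‖² + ‖w_k‖²)`, and its sum is the basis-free number
`Σ_k λ_k ⟨Y† w_k, P_V X u_k⟩`. [cite: ReedSimon1972, Thm. VI.18 and VI.24, PDF pp. 196–199] -/
theorem rankOne_sandwich_diag_coe (f : HilbertBasis ι ℂ V) {T X Y : E →L[ℂ] E} {u w : κ → E} {lam : κ → ℂ}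
    (hT : ∀ φ : E, HasSum (fun k => (lam k * ⟪w k, φ⟫_ℂ) • u k) (T φ))
    (hsum : Summable fun k => ‖lam k‖ * (‖u k‖ ^ 2 + ‖w k‖ ^ 2)) :
    (Summable fun i => ‖⟪(f i : E), X (T (Y (f i : E)))⟫_ℂ‖) ∧
    ∑' i, ‖⟪(f i : E), X (T (Y (f i : E)))⟫_ℂ‖ ≤
      (‖X‖ ^ 2 + ‖Y‖ ^ 2) * ∑' k, ‖lam k‖ * (‖u k‖ ^ 2 + ‖w k‖ ^ 2) ∧
    ∑' i, ⟪(f i : E), X (T (Y (f i : E)))⟫_ℂ =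
      ∑' k, lam k * ⟪ContinuousLinearMap.adjoint Y (w k), V.starProjection (X (u k))⟫_ℂ := by
  have he := HilbertBasis.orthonormal_coe f
  set p : κ → E := fun k => X (u k) with hp
  set q : κ → E := fun k => ContinuousLinearMap.adjoint Y (w k) with hq
  -- the transported summability
  have hle : ∀ k, ‖lam k‖ * (‖p k‖ ^ 2 + ‖q k‖ ^ 2) ≤ (‖X‖ ^ 2 + ‖Y‖ ^ 2) * (‖lam k‖ * (‖u k‖ ^ 2 + ‖w k‖ ^ 2)) := by
    intro k
    have h1 : ‖p k‖ ≤ ‖X‖ * ‖u k‖ := X.le_opNorm (u k)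
    have h2 : ‖q k‖ ≤ ‖Y‖ * ‖w k‖ := by
      have := (ContinuousLinearMap.adjoint Y).le_opNorm (w k)
      rwa [LinearIsometryEquiv.norm_map] at this
    have h1' : ‖p k‖ ^ 2 ≤ ‖X‖ ^ 2 * ‖u k‖ ^ 2 := by
      rw [← mul_pow]; exact pow_le_pow_left₀ (norm_nonneg _) h1 2
    have h2' : ‖q k‖ ^ 2 ≤ ‖Y‖ ^ 2 * ‖w k‖ ^ 2 := by
      rw [← mul_pow]; exact pow_le_pow_left₀ (norm_nonneg _) h2 2
    have hX := sq_nonneg ‖X‖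
    have hY := sq_nonneg ‖Y‖
    have hu := sq_nonneg ‖u k‖
    have hw := sq_nonneg ‖w k‖
    have hl := norm_nonneg (lam k)
    nlinarith [mul_nonneg hX hw, mul_nonneg hY hu, mul_nonneg hl (mul_nonneg hX hw), mul_nonneg hl (mul_nonneg hY hu)]
  have hsum' : Summable fun k => ‖lam k‖ * (‖p k‖ ^ 2 + ‖q k‖ ^ 2) :=
    Summable.of_nonneg_of_le (fun k => by positivity) hle (hsum.mul_left _)
  obtain ⟨-, hS, hB⟩ := tsum_norm_rankOne_diag_le he p q lam hsum'
  -- the diagonal coefficient is the rank-one series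
  have hdiag : ∀ i, ⟪(f i : E), X (T (Y (f i : E)))⟫_ℂ = ∑' k, lam k * (⟪(f i : E), p k⟫_ℂ * ⟪q k, (f i : E)⟫_ℂ) :=
    fun i => ((hasSum_inner_sandwich (X := X) (Y := Y) hT (f i : E)).tsum_eq).symm
  simp_rw [hdiag]
  refine ⟨hS, hB.trans ?_, (tsum_tsum_rankOne_diag_coe_eq f p q lam hsum').2⟩
  rw [← tsum_mul_left]
  exact Summable.tsum_le_tsum hle hsum' (hsum.mul_left _)

end Literature.Analysis.OperatorTheory
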